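import Summits.ResolutionOfSingularities.ResolutionOfSingularities.Theorems.FrobeniusClosingPatchingRelPerfectDepthPhaseCContactCureDim
import Literature.AlgebraicGeometry.Resolution.SncSaturatedCentre
import Literature.AlgebraicGeometry.Resolution.BlowupDisjointCentreWeights
import Literature.AlgebraicGeometry.Resolution.ComponentGluing
import HarnessLib

/-!
# Crux `PatchingRelPerfect` (stmt-ResolutionOfSingularities-16161), chain W5.2 — F7(β) (β-AX) X3 C-I (M2b) cure §1b, TOPOLOGY: «NO COMPONENT OF THE
# CONTACT SURFACE LIES IN THE BOUNDARY» from the pointwise contact data (NF1, stalkwise principal entries, carrier ≠ member at the stalk) and LEG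

[OURS · L1 W5.2 · cure plan of record (res-L1-w52-lead-1 g6, 22:35Z).]  Replaces the role of NO printed item; NOT a statement of the manuscript
under review (AI-written; AI review weaker than expert review; counted 0).  Def-free, fact-free.  Discharges the hypothesis `hcomp` of
`exists_realisedCure_of_F60` (…ContactCurePw §1): a component `C` of `(Sfc ∩ W)_red` inside the boundary `B` lies in `Sfc ∩ B ∩ W ⊆ P` (LEG), so
its generic point `η` is a point of the piece; there `η` is a maximal point of `Supp (V ⊔ Φ)` for the carrier `V` and an entry `Φ ≠ V` through
`η` (maximality of `C`), hence `dim 𝒪_η ≤ 2` (…CureDim, Krull); the carrier and the member `T ∋ η` are two snc members with different stalks, so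
`V_η ⊔ T_η = 𝔪_η ⊇ Φ_η` (…CureDim) — contradicting NF1 `Φ_η ⊄ V_η ⊔ T_η`.

## References
* H. Matsumura, *Commutative Ring Theory* (1987), Thm. 13.5, Thm. 14.2. [Matsumura1987]
* The Stacks Project, Tag 01J7, Tag 004W. [StacksProject]
-/

-- `Summit.<Summit>.<Sub>.Theorems` with `Sub = Summit` (single-conjunct summit, D-0017)
set_option linter.dupNamespace false

noncomputable section

namespace Summit.ResolutionOfSingularities.ResolutionOfSingularities.Theorems.X3LemmaM

open CategoryTheory AlgebraicGeometry TopologicalSpace IsLocalRing Topology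
open Literature.AlgebraicGeometry.Resolution
open Scheme.IdealSheafData

universe u

/-! ## §1 Generic points of irreducible components are maximal -/

/-- In a T₀ space, a point specialising to the generic point of an irreducible COMPONENT is that generic point. [cite: StacksProject, Tag 004W] -/
theorem eq_of_specializes_isGenericPoint_component {Y : Type*} [TopologicalSpace Y] [T0Space Y] {T : Set Y}
    (hT : T ∈ irreducibleComponents Y) {z₀ z₁ : Y} (hz₀ : IsGenericPoint z₀ T) (h : z₁ ⤳ z₀) : z₁ = z₀ := by
  have h1 : T ⊆ closure {z₁} := by
    rw [← hz₀.def]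
    exact closure_minimal (Set.singleton_subset_iff.mpr (specializes_iff_mem_closure.mp h)) isClosed_closure
  have h2 : closure {z₁} ⊆ T := hT.2 isIrreducible_singleton.closure h1
  have h3 : z₁ ∈ T := h2 (subset_closure (Set.mem_singleton z₁))
  have h4 : z₀ ⤳ z₁ := hz₀.specializes h3
  exact (h.antisymm h4).eq

/-! ## §2 Transport of stalk ideals along an open immersion -/

section transport

variable {U X : Scheme.{u}} (j : U ⟶ X) [IsOpenImmersion j] (u : U)

/-- Stalk ideals of pulled-back ideal sheaves along an open immersion are the images under the stalk ISOMORPHISM; mapping back recovers the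
ideal. [folklore] -/
theorem map_inv_stalkIdeal_comap (I : X.IdealSheafData) :
    (stalkIdeal (I.comap j) u).map (inv (j.stalkMap u)).hom = stalkIdeal I (j.base u) := by
  rw [stalkIdeal_comap_eq_map_stalkMap, Ideal.map_map, ← CommRingCat.hom_comp, IsIso.hom_inv_id, CommRingCat.hom_id, Ideal.map_id]

/-- Different stalks stay different after pull-back along an open immersion. [folklore] -/
theorem stalkIdeal_comap_ne {I J : X.IdealSheafData} (h : stalkIdeal I (j.base u) ≠ stalkIdeal J (j.base u)) :
    stalkIdeal (I.comap j) u ≠ stalkIdeal (J.comap j) u := by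
  intro heq
  apply h
  rw [← map_inv_stalkIdeal_comap j u I, ← map_inv_stalkIdeal_comap j u J, heq]

/-- Pulling an inclusion of stalk ideals back from the open. [folklore] -/
theorem stalkIdeal_le_sup_of_comap {I J K : X.IdealSheafData}
    (h : stalkIdeal (K.comap j) u ≤ stalkIdeal (I.comap j) u ⊔ stalkIdeal (J.comap j) u) :
    stalkIdeal K (j.base u) ≤ stalkIdeal I (j.base u) ⊔ stalkIdeal J (j.base u) := by
  rw [← map_inv_stalkIdeal_comap j u I, ← map_inv_stalkIdeal_comap j u J, ← map_inv_stalkIdeal_comap j u K, ← Ideal.map_sup]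
  exact Ideal.map_mono h

/-- The local ring of the open at `u` has the dimension of the local ring of `X` at `j u`. [folklore] -/
theorem ringKrullDim_stalk_eq : ringKrullDim (U.presheaf.stalk u) = ringKrullDim (X.presheaf.stalk (j.base u)) :=
  (RingEquiv.ringKrullDim (asIso (j.stalkMap u)).commRingCatIsoToRingEquiv).symm

end transport

/-! ## §3 No component of the contact surface inside the boundary -/

open Classical in
/-- [OURS · L1 W5.2 · cure §1b] **NO IRREDUCIBLE COMPONENT OF `(Sfc ∩ W)_red` LIES IN THE BOUNDARY** — the hypothesis `hcomp` of
`exists_realisedCure_of_F60`, from LEG (boundary part) and the pointwise contact data of `HasContactFormOnPw₅` at the points of `P ∩ W`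
(carrier `V` principal and different from every member at the stalk, simple normal crossings of `V :: members through x` on a patch, entries
`Φ` stalkwise principal with NF1, and the set clause `Sfc ∩ W' = Supp V ∩ ⋃_{Φ ≠ V} Supp Φ ∩ W'`). [cite: Matsumura1987, Thm. 13.5, Thm. 14.2]
[cite: StacksProject, Tag 01J7] -/
theorem not_subset_boundary_of_mem_irreducibleComponents {X : Scheme.{u}} [IsNoetherian X]
    (E : List X.IdealSheafData) (Sfc : Set X) (hSfc : IsClosed Sfc) (P : Set X) (W : X.Opens)
    (hLEGB : ∀ y ∈ (W : Set X), y ∈ Sfc → y ∈ (⋃ D ∈ E, (D.support : Set X)) → y ∈ P)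
    (hpt : ∀ x ∈ P, x ∈ (W : Set X) → ∃ (V : X.IdealSheafData) (W' : X.Opens) (𝓒 : List X.IdealSheafData), x ∈ (W' : Set X) ∧
      (∀ T ∈ E, x ∈ (T.support : Set X) → stalkIdeal V x ≠ stalkIdeal T x) ∧
      (∃ v : X.presheaf.stalk x, stalkIdeal V x = Ideal.span {v}) ∧
      HasSNC ((V :: E.filter fun T => decide (x ∈ (T.support : Set X))).map fun F => F.comap W'.ι) ∧
      (∀ Φ ∈ 𝓒, ∃ φ : X.presheaf.stalk x, stalkIdeal Φ x = Ideal.span {φ}) ∧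
      (∀ Φ ∈ 𝓒, Φ ≠ V → x ∈ (Φ.support : Set X) →
        ∀ T ∈ E, x ∈ (T.support : Set X) → ¬ stalkIdeal Φ x ≤ stalkIdeal V x ⊔ stalkIdeal T x) ∧
      Sfc ∩ (W' : Set X) = (V.support : Set X) ∩ (⋃ Φ ∈ 𝓒, ⋃ (_ : Φ ≠ V), (Φ.support : Set X)) ∩ (W' : Set X)) :
    ∀ T ∈ irreducibleComponents ((vanishingIdeal ((⟨Sfc, hSfc⟩ : Closeds X).preimage W.ι.continuous)).subscheme : Type u),
      ¬ T ⊆ (vanishingIdeal ((⟨Sfc, hSfc⟩ : Closeds X).preimage W.ι.continuous)).subschemeι.base ⁻¹'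
        (W.ι.base ⁻¹' ⋃ D ∈ E, (D.support : Set X)) := by
  set J : (W : Scheme.{u}).IdealSheafData := vanishingIdeal ((⟨Sfc, hSfc⟩ : Closeds X).preimage W.ι.continuous) with hJ
  intro T hT hTB
  -- the composite immersion `g : V(J) ⟶ W ⟶ X` and its range `Sfc ∩ W`
  set g : J.subscheme ⟶ X := J.subschemeι ≫ W.ι with hg
  have hgind : IsInducing g.base := by
    rw [hg, Scheme.Hom.comp_base, TopCat.coe_comp]
    exact W.ι.isOpenEmbedding.isInducing.comp J.subschemeι.isClosedEmbedding.isInducing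
  have hrangeJ : Set.range J.subschemeι.base = W.ι.base ⁻¹' Sfc := by
    rw [Scheme.IdealSheafData.range_subschemeι, hJ, Scheme.IdealSheafData.coe_support_vanishingIdeal]; rfl
  have hgmem : ∀ z : J.subscheme, g.base z ∈ Sfc ∧ g.base z ∈ (W : Set X) := by
    intro z
    refine ⟨?_, ?_⟩
    · have : J.subschemeι.base z ∈ W.ι.base ⁻¹' Sfc := hrangeJ ▸ Set.mem_range_self z
      simpa [hg] using this
    · rw [hg, Scheme.Hom.comp_base, TopCat.coe_comp, Function.comp_apply, ← Scheme.Opens.range_ι W]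
      exact Set.mem_range_self _
  have hglift : ∀ ζ : X, ζ ∈ Sfc → ζ ∈ (W : Set X) → ∃ z : J.subscheme, g.base z = ζ := by
    intro ζ hζS hζW
    rw [← Scheme.Opens.range_ι W] at hζW
    obtain ⟨w, rfl⟩ := hζW
    have hw : w ∈ Set.range J.subschemeι.base := by rw [hrangeJ]; exact hζS
    obtain ⟨z, rfl⟩ := hw
    exact ⟨z, by rw [hg, Scheme.Hom.comp_base, TopCat.coe_comp, Function.comp_apply]⟩
  -- the generic point of the component and its image `η ∈ P`
  set z₀ : J.subscheme := (genericPoints.ofComponent ⟨T, hT⟩).1 with hz₀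
  have hz₀gen : IsGenericPoint z₀ T := genericPoints.isGenericPoint_ofComponent ⟨T, hT⟩
  have hz₀T : z₀ ∈ T := hz₀gen.mem
  set η : X := g.base z₀ with hη
  have hηB : η ∈ ⋃ D ∈ E, (D.support : Set X) := by
    have := hTB hz₀T
    simpa [hη, hg] using this
  obtain ⟨hηS, hηW⟩ := hgmem z₀
  have hηP : η ∈ P := hLEGB η hηW hηS hηB
  -- the contact data at `η`
  obtain ⟨V, W', 𝓒, hηW', hVT, ⟨v, hv⟩, hsnc, hprin, hNF1, hset⟩ := hpt η hηP hηW
  -- an entry through `η`, and a member through `η`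
  have hηSW' : η ∈ Sfc ∩ (W' : Set X) := ⟨hηS, hηW'⟩
  rw [hset] at hηSW'
  obtain ⟨⟨hηV, hηU⟩, -⟩ := hηSW'
  simp only [Set.mem_iUnion, exists_prop] at hηU
  obtain ⟨Φ, hΦ𝓒, hΦV, hηΦ⟩ := hηU
  simp only [Set.mem_iUnion, exists_prop] at hηB
  obtain ⟨T', hT'E, hηT'⟩ := hηB
  obtain ⟨φ, hφ⟩ := hprin Φ hΦ𝓒
  -- `η` is a maximal point of `Supp (V ⊔ Φ)`
  have hmax : η ∈ maxPoints (((V ⊔ Φ).support : Set X)) := by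
    refine ⟨?_, fun ζ hζ hζη => ?_⟩
    · rw [Scheme.IdealSheafData.support_sup]; exact ⟨hηV, hηΦ⟩
    · rw [Scheme.IdealSheafData.support_sup] at hζ
      obtain ⟨hζV, hζΦ⟩ := hζ
      have hζW' : ζ ∈ (W' : Set X) := hζη.mem_open W'.isOpen hηW'
      have hζW : ζ ∈ (W : Set X) := hζη.mem_open W.isOpen hηW
      have hζS : ζ ∈ Sfc := by
        have : ζ ∈ Sfc ∩ (W' : Set X) := by
          rw [hset]
          refine ⟨⟨hζV, ?_⟩, hζW'⟩
          simp only [Set.mem_iUnion, exists_prop]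
          exact ⟨Φ, hΦ𝓒, hΦV, hζΦ⟩
        exact this.1
      obtain ⟨z₁, hz₁⟩ := hglift ζ hζS hζW
      have hspec : z₁ ⤳ z₀ := by
        rw [← hgind.specializes_iff, hz₁]; exact hζη
      have := eq_of_specializes_isGenericPoint_component hT hz₀gen hspec
      rw [← hz₁, this]
  -- Krull: `dim 𝒪_η ≤ 2`
  have hdim : ringKrullDim (X.presheaf.stalk η) ≤ 2 := ringKrullDim_stalk_le_two_of_mem_maxPoints hmax hv hφ
  -- on the patch `W'`: the carrier and the member span the maximal ideal
  have hηW'r : η ∈ Set.range W'.ι.base := by rw [Scheme.Opens.range_ι]; exact hηW'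
  obtain ⟨η', hη'⟩ := hηW'r
  have hmemV : V.comap W'.ι ∈ (V :: E.filter fun T => decide (η ∈ (T.support : Set X))).map fun F => F.comap W'.ι :=
    List.mem_map.mpr ⟨V, List.mem_cons_self, rfl⟩
  have hmemT : T'.comap W'.ι ∈ (V :: E.filter fun T => decide (η ∈ (T.support : Set X))).map fun F => F.comap W'.ι :=
    List.mem_map.mpr ⟨T', List.mem_cons_of_mem _ (List.mem_filter.mpr ⟨hT'E, by simpa using hηT'⟩), rfl⟩
  have hη'V : η' ∈ ((V.comap W'.ι).support : Set (W' : Scheme.{u})) := (mem_support_comap_iff W'.ι V η').mpr (hη' ▸ hηV)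
  have hη'T : η' ∈ ((T'.comap W'.ι).support : Set (W' : Scheme.{u})) := (mem_support_comap_iff W'.ι T' η').mpr (hη' ▸ hηT')
  have hne' : stalkIdeal (V.comap W'.ι) η' ≠ stalkIdeal (T'.comap W'.ι) η' :=
    stalkIdeal_comap_ne W'.ι η' (by rw [hη']; exact hVT T' hT'E hηT')
  have hdim' : ringKrullDim ((W' : Scheme.{u}).presheaf.stalk η') ≤ 2 := by
    rw [ringKrullDim_stalk_eq W'.ι η', hη']; exact hdim
  have hsup := stalkIdeal_sup_eq_maximalIdeal_of_hasSNC hsnc hmemV hmemT hη'V hη'T hne' hdim'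
  -- the entry `Φ` is a proper ideal at `η'`, hence inside `𝔪 = V ⊔ T'`; pull back to `X`: contradiction with NF1
  have hη'Φ : η' ∈ ((Φ.comap W'.ι).support : Set (W' : Scheme.{u})) := (mem_support_comap_iff W'.ι Φ η').mpr (hη' ▸ hηΦ)
  have hle' : stalkIdeal (Φ.comap W'.ι) η' ≤ stalkIdeal (V.comap W'.ι) η' ⊔ stalkIdeal (T'.comap W'.ι) η' := by
    rw [hsup]; exact (mem_support_iff_stalkIdeal_le _ _).mp hη'Φ
  have hle := stalkIdeal_le_sup_of_comap W'.ι η' hle'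
  rw [hη'] at hle
  exact hNF1 Φ hΦ𝓒 hΦV hηΦ T' hT'E hηT' hle

end Summit.ResolutionOfSingularities.ResolutionOfSingularities.Theorems.X3LemmaM

end
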